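import Literature.Topology.FourManifolds.BandSumFoxMilnor
import Literature.Topology.FourManifolds.SliceRibbonIsotopyProofs
import Literature.Topology.FourManifolds.SliceRibbonUnknotProofs
import Literature.Topology.FourManifolds.ConcordanceTransitivity
import Literature.Topology.FourManifolds.ConnectedSumNormalFormProofs
import Literature.Topology.FourManifolds.SchubertRegular
import Literature.Topology.FourManifolds.BandSumIsotopyRegularProofs
import Literature.Topology.FourManifolds.BandSumConcordanceRegular
import HarnessLib

/-!
# Fox–Milnor, `K # (-K̄)` is slice: the exact upstream sets

Sibling proof file of `BandSumFoxMilnor.lean` for the named fact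
`Literature.Topology.FourManifolds.Knot.isSmoothlySlice_of_isConnectedSum_mirror_reverse`
(`BandSum.lean`; Fox–Milnor (1966), §3, Lemma 3, p. 263 of the held copy: "`κ + (−κ)` is a slice
type", `−κ` the class of the knot with the orientations of the knot and of `S³` both reversed,
i.e. `K.mirror.reverse`; the sum of types is well defined by Schubert, footnote 3, p. 258).

`BandSumFoxMilnor.lean` proves the assembly
`Knot.isSmoothlySlice_of_isConnectedSum_mirror_reverse_of : (A) → (B) → (C) → fact` with
(A) *some* connected sum of `K` and `K.mirror.reverse` is slice (the symmetric union and its chord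
disc, `Knot.isSmoothlySlice_of_symmetric`), (B) `Knot.IsConnectedSum.isIsotopic` (Schubert) and
(C) `Knot.IsSmoothlySlice.of_isIsotopic`. Since then (C) has been discharged
(`Knot.IsSmoothlySlice.of_isIsotopic_holds`, `SliceRibbonIsotopyProofs.lean`), the concordance group
structure has been proved (`equivalence_isConcordant_holds`, `ConcordanceTransitivity.lean`;
`Knot.isSmoothlySlice_iff_isConcordant_unknot_holds`, `SliceRibbonUnknotProofs.lean`), and the fact
seats of (B) have (i) reduced it to three named facts
(`Knot.IsConnectedSum.isIsotopic_of_ball_of_exists_ambientIsotopy_of_rebuilt`,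
`ConnectedSumNormalFormProofs.lean`) and (ii) recorded that the tree's corner-free `BandData`
states (B) and the band fact more generally than any printed source, vendoring the printed
(*regular*) statements `Knot.IsRegularConnectedSum.isIsotopic`,
`BandData.isIsotopic_of_band_eq_of_isRegular` (`SchubertRegular.lean`, `BandSumIsotopyRegular.lean`).

This file records, with everything else proved, what the Fox–Milnor fact is waiting for, in both
readings. Nothing here is new mathematics; each theorem is a composition of theorems of the tree.

* `Knot.isSmoothlySlice_of_isConnectedSum_mirror_reverse_of_isConcordant_of_isConnectedSum` — the
  **weakest form of (B) that suffices**: uniqueness of `#` up to *concordance* (not isotopy),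
  because sliceness is a concordance invariant (`K' ~ K₀ ~ O`). Corollaries: the fact from (A) and
  the Fox–Milnor congruence `Knot.IsConnectedSum.isConcordant` (named fact of `BandSum.lean`), and
  from (A) and (B) alone (`…_of_isIsotopic`, the assembly of `BandSumFoxMilnor.lean` with (C)
  discharged).
* `Knot.isSmoothlySlice_of_isConnectedSum_mirror_reverse_of_ball_of_exists_ambientIsotopy_of_rebuilt`
  — the **exact upstream set of the fact as stated** (corner-free witnesses): (A), the ball form of
  the smooth Schoenflies theorem in `𝕊³` (`SphereEmbedding.schoenflies_exists_ball`), the band fact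
  in geometric form (`BandData.exists_ambientIsotopy_of_band_eq`, the corner-free statement flagged
  in `BandSumIsotopyRegular.lean`) and Schubert's theorem for rebuilt presentations
  (`Knot.Schubert1949_normalPosition_rebuilt`, `SchubertNormalForm.lean`).
* `Knot.isSmoothlySlice_of_isRegularConnectedSum_mirror_reverse_of`,
  `Knot.isSmoothlySlice_of_isRegularConnectedSum_mirror_reverse_of_ball_of_rebuilt` — the
  **printed reading** (regular witnesses, `Knot.IsRegularConnectedSum`): (A) with a regular
  witness, Schoenflies in ball form and the rebuilt heart, the printed band fact
  `BandData.isIsotopic_of_band_eq_of_isRegular` being *proved*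
  (`BandData.isIsotopic_of_band_eq_of_isRegular_holds`, `BandSumIsotopyRegularProofs.lean`); and
  `Knot.isSmoothlySlice_of_isRegularConnectedSum_mirror_reverse_of_general` — the fact as stated
  implies its printed reading.

In every reading the geometric input (A) is kept as an explicit hypothesis (it is the remaining
brick of `BandSumFoxMilnor.lean`, NOT vendored as a named fact); a construction of (A) should
produce a *regular* witness (an explicit band that is an injective immersion on a larger collar),
which serves both readings (`IsRegularConnectedSum.isConnectedSum`).

## The printed reading in normal position, and the verdict on scope (2026-08-15)

*Source.* Fox–Milnor (1966), §3, Lemma 3 (p. 263 of the held copy): "If `κ` is any knot type,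
then `κ + (−κ)` is a slice type", `+` being the product of knot **types** (p. 258, footnote 3:
Schubert (1949)) and `−κ` the type of a representative with the orientations of the knot and of
`3`-space both reversed (proof of Lemma 3: "reversing the orientation of `k` and reflecting it"),
i.e. `K.mirror.reverse`. The printed proof exhibits ONE representative `k''` of `κ + (−κ)`,
symmetric about a plane and meeting it in two points, and its disc
`{(x₁, x₂, x₃, x₄) : (x₁, x₂, |x₃| + |x₄|) ∈ k''}`; "every representative is slice" is then
Schubert's theorem. In the tree's presentation language the printed statement therefore concerns
the classical product along an embedded **closed** rectangle (Cromwell (2004), §4.6, p. 69), i.e.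
the *regular* presentations `Knot.IsRegularConnectedSum` / `Knot.IsRegularNormalConnectedSum`
(`SchubertRegular.lean`), exactly as recorded for the sibling facts `Knot.IsConnectedSum.isConcordant`
and `BandData.isIsotopic_of_band_eq` (deprecated as *misstated — wider than the sources* in
`BandSum.lean`, 2026-08-15). The named fact of this seat quantifies over all **corner-free**
witnesses of `Knot.IsConnectedSum`; by
`isSmoothlySlice_of_isConnectedSum_mirror_reverse_of_ball_of_exists_ambientIsotopy_of_rebuilt`
below its surplus over the printed statement is at most the corner-free band fact
`BandData.exists_ambientIsotopy_of_band_eq`, covered by no printed proof (no counterexample is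
known). **Verdict of this seat: misstated (wider than the source); the corrected (printed)
statements are the conclusions of the `IsRegular…` theorems of this file**, written out rather
than named (no new `def … : Prop`, D-0026), as was done for the corrected congruence
(`Knot.IsRegularConnectedSum.isConcordant_of_isIsotopic`, `BandSumConcordanceRegular.lean`). The
corner-free statement in `BandSum.lean` is left untouched here (its other seat's assembly
`BandSumFoxMilnor.lean` and `RasmussenConcordanceProofs.lean` consume it verbatim).

*Normal position.* The second group of theorems added on 2026-08-15 is the reading that the
consumer actually needs and that avoids the Schoenflies theorem altogether: for **regular normal**
presentations (`Knot.IsRegularNormalConnectedSum`: summands in the two open hemispheres, the band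
crossing the equator `{x₃ = 0}` in its middle segment, regular band) Schubert's theorem is
`Knot.Schubert1949_normalPosition_regular`, which follows from the heart
`Knot.Schubert1949_normalPosition_rebuilt` alone (`Schubert1949_normalPosition_regular_of_rebuilt`,
the printed band fact being proved), and two regular normal presentations with isotopic summands
are isotopic (`IsRegularNormalConnectedSum.isIsotopic_of_normalPosition_regular`,
`BandSumConcordanceNormalRegular.lean`, proved). Hence:

* `Knot.isSmoothlySlice_of_isRegularNormalConnectedSum_mirror_reverse_of_normalPosition_regular`,
  `…_of_rebuilt` — **every regular normal presentation of `K # (-K̄)` is smoothly slice**, from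
  (A) with a regular normal witness (`hA`; this is precisely what the symmetric model under
  construction in `FoxMilnorChart.lean` and its sequels delivers: `K` in the northern hemisphere,
  `R K` reversed in the southern one, a band of rays crossing the equator) and the heart ALONE —
  upstream set {`Knot.Schubert1949_normalPosition_rebuilt`}, no Schoenflies;
* `Knot.isSmoothlySlice_of_isRegularConnectedSum_mirror_reverse_of_normal_of_ball_of_rebuilt` — all
  regular presentations, from the same `hA`, the ball form of the Schoenflies theorem and the heart
  (`exists_isRegularConnectedSum_mirror_reverse_isSmoothlySlice_of_normal`: a regular normal
  witness is a regular witness is a corner-free witness);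
* `Knot.IsConcordant.exists_isRegularNormalConnectedSum_mirror_reverse_isSmoothlySlice` — the
  package used in Rasmussen's proof that `s` is a concordance invariant
  (`RasmussenConcordanceProofs.lean`, there fed with the corner-free fact): if `K ~ K'` then there
  are regular normal presentations `L = K # (-K̄')`, `L' = K' # (-K̄')` with `L ~ L'`, **both
  smoothly slice** — from `hA` and the heart (`Knot.exists_isRegularNormalConnectedSum_isConcordant_left`,
  proved, supplies `L ~ L'`);
* `Knot.isSmoothlySlice_of_isRegularNormalConnectedSum_mirror_reverse_of_general` — the corner-free
  fact implies the normal reading.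

## References

* R. H. Fox, J. W. Milnor, *Singularities of 2-spheres in 4-space and cobordism of knots*, Osaka
  J. Math. 3 (1966), 257–267, §1 and §3 Lemma 3. [FoxMilnor1966]
* C. Livingston, *A survey of classical knot concordance*, Handbook of Knot Theory (2005), §2.1,
  Thm. 2.2 (arXiv math/0307077). [Livingston2005]
* P. R. Cromwell, *Knots and Links*, Cambridge University Press (2004), §4.6. [Cromwell2004]

## Design notes

* Theorems only: no definition, no named fact (`def … : Prop`), no statement of another file is
  modified, no `sorry` (D-0026). The printed readings (regular, regular normal) are written out as
  the conclusions of the theorems rather than given names.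
-/

open scoped Manifold ContDiff Topology
open Function Set Metric

noncomputable section

namespace Literature.Topology.FourManifolds

namespace Knot

/-! ## Uniqueness of the connected sum up to concordance suffices -/

/-- **Fox–Milnor from (A) and uniqueness of `#` up to concordance.** If every knot `K` has some
slice connected sum `K₀` with `K.mirror.reverse` (`hA`) and any two connected sums of the same
oriented knots are *concordant* (`hB`, a consequence of Schubert's uniqueness up to isotopy, and
the weakest form of it used here), then every connected sum `K'` of `K` and `K.mirror.reverse` is
smoothly slice: `K' ~ K₀ ~ O` and a knot concordant to the unknot is slice
(`isSmoothlySlice_iff_isConcordant_unknot_holds`, `equivalence_isConcordant_holds`).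
Fox–Milnor (1966), §3 Lemma 3 with footnote 3; Livingston (2005), §2.1.
[cite: FoxMilnor1966, §3 Lemma 3] -/
theorem isSmoothlySlice_of_isConnectedSum_mirror_reverse_of_isConcordant_of_isConnectedSum
    (hA : ∀ [SphereEmbedding.SmoothnessFacts] (K : Knot),
      ∃ K₀ : Knot, IsConnectedSum K K.mirror.reverse K₀ ∧ K₀.IsSmoothlySlice)
    (hB : ∀ {K₁ K₂ K K' : Knot}, IsConnectedSum K₁ K₂ K → IsConnectedSum K₁ K₂ K' →
      K.IsConcordant K') :
    isSmoothlySlice_of_isConnectedSum_mirror_reverse := by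
  intro _ K K' h
  obtain ⟨K₀, h₀, hs⟩ := hA K
  have hc : K'.IsConcordant K₀ := hB h h₀
  have h₀O : K₀.IsConcordant unknot := isSmoothlySlice_iff_isConcordant_unknot_holds.1 hs
  exact isSmoothlySlice_iff_isConcordant_unknot_holds.2 (equivalence_isConcordant_holds.trans hc h₀O)

-- `linter.deprecated` is switched off for the next declaration only: its hypothesis `hcong` is the
-- corner-free Fox–Milnor congruence `IsConnectedSum.isConcordant`, deprecated as mis-stated in
-- `BandSum.lean` (2026-08-15); the reduction is kept verbatim for the record of upstream sets (the
-- regular congruence lives in `BandSumConcordanceRegular.lean`).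
set_option linter.deprecated false in
/-- **Fox–Milnor from (A) and the Fox–Milnor congruence.** The named fact
`IsConnectedSum.isConcordant` (`BandSum.lean`: concordance is a congruence for `#`), applied to
the reflexive concordances of the two factors (`IsConcordant.refl'`), gives uniqueness of `#` up
to concordance, hence the fact by
`isSmoothlySlice_of_isConnectedSum_mirror_reverse_of_isConcordant_of_isConnectedSum`.
Fox–Milnor (1966), §1 and §3 Lemma 3. [cite: FoxMilnor1966, §3 Lemma 3] -/
theorem isSmoothlySlice_of_isConnectedSum_mirror_reverse_of_isConcordant
    (hA : ∀ [SphereEmbedding.SmoothnessFacts] (K : Knot),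
      ∃ K₀ : Knot, IsConnectedSum K K.mirror.reverse K₀ ∧ K₀.IsSmoothlySlice)
    (hcong : IsConnectedSum.isConcordant) : isSmoothlySlice_of_isConnectedSum_mirror_reverse :=
  isSmoothlySlice_of_isConnectedSum_mirror_reverse_of_isConcordant_of_isConnectedSum hA
    fun hK hK' ↦ hcong hK hK' (IsConcordant.refl' _) (IsConcordant.refl' _)

/-- **Fox–Milnor from (A) and (B) alone**: the assembly
`isSmoothlySlice_of_isConnectedSum_mirror_reverse_of` of `BandSumFoxMilnor.lean` with its third
hypothesis (C), isotopy invariance of sliceness, discharged (`IsSmoothlySlice.of_isIsotopic_holds`,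
`SliceRibbonIsotopyProofs.lean`). Fox–Milnor (1966), §3 Lemma 3. [cite: FoxMilnor1966, §3 Lemma 3] -/
theorem isSmoothlySlice_of_isConnectedSum_mirror_reverse_of_isIsotopic
    (hA : ∀ [SphereEmbedding.SmoothnessFacts] (K : Knot),
      ∃ K₀ : Knot, IsConnectedSum K K.mirror.reverse K₀ ∧ K₀.IsSmoothlySlice)
    (hB : IsConnectedSum.isIsotopic) : isSmoothlySlice_of_isConnectedSum_mirror_reverse :=
  isSmoothlySlice_of_isConnectedSum_mirror_reverse_of hA hB IsSmoothlySlice.of_isIsotopic_holds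

/-! ## The exact upstream set of the fact as stated (corner-free witnesses) -/

/-- **The Fox–Milnor fact, reduced to (A) and three named facts.** Every connected sum of `K` and
`K.mirror.reverse` (in the tree's corner-free sense `IsConnectedSum`) is smoothly slice, granted:
(A) some such connected sum is slice, for every `K` (`hA`); the ball form of the smooth Schoenflies
theorem in `𝕊³` (`hBall`, `SphereEmbedding.schoenflies_exists_ball`, Alexander (1924)); band sums
along the same band have ambient isotopic oriented images (`hgeom`,
`BandData.exists_ambientIsotopy_of_band_eq`, the corner-free form — see `BandSumIsotopyRegular.lean`
for its scope); and Schubert's theorem for rebuilt presentations in normal position (`hR`,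
`Knot.Schubert1949_normalPosition_rebuilt`). The last three give (B) by
`IsConnectedSum.isIsotopic_of_ball_of_exists_ambientIsotopy_of_rebuilt`
(`ConnectedSumNormalFormProofs.lean`). Fox–Milnor (1966), §3 Lemma 3; Cromwell (2004), §4.6.
[cite: FoxMilnor1966, §3 Lemma 3] -/
theorem isSmoothlySlice_of_isConnectedSum_mirror_reverse_of_ball_of_exists_ambientIsotopy_of_rebuilt
    (hA : ∀ [SphereEmbedding.SmoothnessFacts] (K : Knot),
      ∃ K₀ : Knot, IsConnectedSum K K.mirror.reverse K₀ ∧ K₀.IsSmoothlySlice)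
    (hBall : SphereEmbedding.schoenflies_exists_ball)
    (hgeom : BandData.exists_ambientIsotopy_of_band_eq) (hR : Schubert1949_normalPosition_rebuilt) :
    isSmoothlySlice_of_isConnectedSum_mirror_reverse :=
  isSmoothlySlice_of_isConnectedSum_mirror_reverse_of_isIsotopic hA
    (IsConnectedSum.isIsotopic_of_ball_of_exists_ambientIsotopy_of_rebuilt hBall hgeom hR)

/-! ## The printed reading: regular witnesses -/

/-- **The fact as stated implies its printed reading**: if every corner-free connected sum of `K`
and `K.mirror.reverse` is slice, so is every regular one (`IsRegularConnectedSum.isConnectedSum`).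
[folklore] -/
theorem isSmoothlySlice_of_isRegularConnectedSum_mirror_reverse_of_general
    (h : isSmoothlySlice_of_isConnectedSum_mirror_reverse) :
    ∀ [SphereEmbedding.SmoothnessFacts] {K K' : Knot},
      IsRegularConnectedSum K K.mirror.reverse K' → K'.IsSmoothlySlice :=
  fun h' ↦ h h'.isConnectedSum

/-- **Fox–Milnor, printed reading, assembled.** If every knot `K` has some slice *regular*
connected sum with `K.mirror.reverse` (`hA`: an explicit symmetric union along an embedded closed
rectangle) and regular connected sums are unique up to isotopy (`hB`,
`IsRegularConnectedSum.isIsotopic`, the printed form of Schubert's theorem, `SchubertRegular.lean`),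
then every regular connected sum of `K` and `K.mirror.reverse` is smoothly slice (isotopy
invariance of sliceness being `IsSmoothlySlice.of_isIsotopic_holds`). Fox–Milnor (1966), §3
Lemma 3 with footnote 3 (Schubert); Cromwell (2004), §4.6. [cite: FoxMilnor1966, §3 Lemma 3] -/
theorem isSmoothlySlice_of_isRegularConnectedSum_mirror_reverse_of
    (hA : ∀ [SphereEmbedding.SmoothnessFacts] (K : Knot),
      ∃ K₀ : Knot, IsRegularConnectedSum K K.mirror.reverse K₀ ∧ K₀.IsSmoothlySlice)
    (hB : IsRegularConnectedSum.isIsotopic) :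
    ∀ [SphereEmbedding.SmoothnessFacts] {K K' : Knot},
      IsRegularConnectedSum K K.mirror.reverse K' → K'.IsSmoothlySlice := by
  intro _ K K' h
  obtain ⟨K₀, h₀, hs⟩ := hA K
  exact IsSmoothlySlice.of_isIsotopic_holds (hB h₀ h) hs

/-- **Fox–Milnor, printed reading, reduced to (A) and two named facts**: (A) with a regular
witness (`hA`), the ball form of the smooth Schoenflies theorem in `𝕊³` (`hBall`,
`SphereEmbedding.schoenflies_exists_ball`) and Schubert's theorem for rebuilt presentations
(`hR`, `Knot.Schubert1949_normalPosition_rebuilt`); together with the *proved* printed band fact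
(`BandData.isIsotopic_of_band_eq_of_isRegular_holds`, `BandSumIsotopyRegularProofs.lean`) the last
two give regular Schubert by `IsRegularConnectedSum.isIsotopic_of_ball_of_regular_band_eq_of_rebuilt`
(`SchubertRegular.lean`). Fox–Milnor (1966), §3 Lemma 3; Cromwell (2004), §4.6.
[cite: FoxMilnor1966, §3 Lemma 3] -/
theorem isSmoothlySlice_of_isRegularConnectedSum_mirror_reverse_of_ball_of_rebuilt
    (hA : ∀ [SphereEmbedding.SmoothnessFacts] (K : Knot),
      ∃ K₀ : Knot, IsRegularConnectedSum K K.mirror.reverse K₀ ∧ K₀.IsSmoothlySlice)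
    (hBall : SphereEmbedding.schoenflies_exists_ball) (hR : Schubert1949_normalPosition_rebuilt) :
    ∀ [SphereEmbedding.SmoothnessFacts] {K K' : Knot},
      IsRegularConnectedSum K K.mirror.reverse K' → K'.IsSmoothlySlice :=
  isSmoothlySlice_of_isRegularConnectedSum_mirror_reverse_of hA
    (IsRegularConnectedSum.isIsotopic_of_ball_of_regular_band_eq_of_rebuilt hBall
      BandData.isIsotopic_of_band_eq_of_isRegular_holds hR)

/-- (A) with a regular witness gives (A) in the corner-free sense, so a single construction of the
symmetric union along an embedded closed rectangle serves both readings. [folklore] -/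
theorem exists_isConnectedSum_mirror_reverse_isSmoothlySlice_of_regular
    (hA : ∀ [SphereEmbedding.SmoothnessFacts] (K : Knot),
      ∃ K₀ : Knot, IsRegularConnectedSum K K.mirror.reverse K₀ ∧ K₀.IsSmoothlySlice)
    [SphereEmbedding.SmoothnessFacts] (K : Knot) :
    ∃ K₀ : Knot, IsConnectedSum K K.mirror.reverse K₀ ∧ K₀.IsSmoothlySlice := by
  obtain ⟨K₀, h₀, hs⟩ := hA K
  exact ⟨K₀, h₀.isConnectedSum, hs⟩

/-! ## The printed reading in normal position: regular normal witnesses, no Schoenflies -/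

/-- (A) with a regular normal witness gives (A) with a regular witness
(`IsRegularNormalConnectedSum.isRegularConnectedSum`: the standard equator splits the summands).
[folklore] -/
theorem exists_isRegularConnectedSum_mirror_reverse_isSmoothlySlice_of_normal
    (hA : ∀ [SphereEmbedding.SmoothnessFacts] (K : Knot),
      ∃ K₀ : Knot, IsRegularNormalConnectedSum K K.mirror.reverse K₀ ∧ K₀.IsSmoothlySlice)
    [SphereEmbedding.SmoothnessFacts] (K : Knot) :
    ∃ K₀ : Knot, IsRegularConnectedSum K K.mirror.reverse K₀ ∧ K₀.IsSmoothlySlice := by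
  obtain ⟨K₀, h₀, hs⟩ := hA K
  exact ⟨K₀, h₀.isRegularConnectedSum, hs⟩

/-- (A) with a regular normal witness gives (A) in the corner-free sense (the hypothesis of the
assembly `isSmoothlySlice_of_isConnectedSum_mirror_reverse_of` of `BandSumFoxMilnor.lean`).
[folklore] -/
theorem exists_isConnectedSum_mirror_reverse_isSmoothlySlice_of_normal
    (hA : ∀ [SphereEmbedding.SmoothnessFacts] (K : Knot),
      ∃ K₀ : Knot, IsRegularNormalConnectedSum K K.mirror.reverse K₀ ∧ K₀.IsSmoothlySlice)
    [SphereEmbedding.SmoothnessFacts] (K : Knot) :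
    ∃ K₀ : Knot, IsConnectedSum K K.mirror.reverse K₀ ∧ K₀.IsSmoothlySlice :=
  exists_isConnectedSum_mirror_reverse_isSmoothlySlice_of_regular
    (exists_isRegularConnectedSum_mirror_reverse_isSmoothlySlice_of_normal hA) K

/-- **Fox–Milnor in normal position, assembled: every regular normal presentation of `K # (-K̄)`
is smoothly slice**, granted (A) with a regular normal witness (`hA`: for every `K` SOME regular
normal presentation `K₀` of `K # K.mirror.reverse` is smoothly slice — the symmetric union of the
printed proof) and Schubert's theorem in normal position for regular presentations (`hH`,
`Knot.Schubert1949_normalPosition_regular`, `SchubertRegular.lean`). Proof: a second regular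
normal presentation `K'` has summands isotopic to those of `K₀`, so `K₀ ≅ K'`
(`IsRegularNormalConnectedSum.isIsotopic_of_normalPosition_regular`, proved from `hH` by the
knots-in-a-ball theorem), and sliceness is an isotopy invariant
(`IsSmoothlySlice.of_isIsotopic_holds`). No Schoenflies theorem is involved. Fox–Milnor (1966),
§3 Lemma 3 (p. 263) with footnote 3 (p. 258); Cromwell (2004), §4.6.
[cite: FoxMilnor1966, §3 Lemma 3, p. 263] -/
theorem isSmoothlySlice_of_isRegularNormalConnectedSum_mirror_reverse_of_normalPosition_regular
    (hA : ∀ [SphereEmbedding.SmoothnessFacts] (K : Knot),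
      ∃ K₀ : Knot, IsRegularNormalConnectedSum K K.mirror.reverse K₀ ∧ K₀.IsSmoothlySlice)
    (hH : Schubert1949_normalPosition_regular) :
    ∀ [SphereEmbedding.SmoothnessFacts] {K K' : Knot},
      IsRegularNormalConnectedSum K K.mirror.reverse K' → K'.IsSmoothlySlice := by
  intro _ K K' h
  obtain ⟨K₀, h₀, hs⟩ := hA K
  exact IsSmoothlySlice.of_isIsotopic_holds (h₀.isIsotopic_of_normalPosition_regular hH h) hs

/-- **Fox–Milnor in normal position, reduced to (A) and the heart alone.** Every regular normal
presentation of `K # K.mirror.reverse` is smoothly slice, granted (A) with a regular normal witness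
(`hA`) and Schubert's theorem for rebuilt presentations in normal position (`hR`,
`Knot.Schubert1949_normalPosition_rebuilt`, `SchubertNormalForm.lean`): the printed band fact is
proved (`BandData.isIsotopic_of_band_eq_of_isRegular_holds`, `BandSumIsotopyRegularProofs.lean`), so
`hR` gives `Schubert1949_normalPosition_regular` (`Schubert1949_normalPosition_regular_of_rebuilt`).
Upstream set: {`Knot.Schubert1949_normalPosition_rebuilt`}. Fox–Milnor (1966), §3 Lemma 3
(p. 263); Cromwell (2004), §4.6. [cite: FoxMilnor1966, §3 Lemma 3, p. 263] -/
theorem isSmoothlySlice_of_isRegularNormalConnectedSum_mirror_reverse_of_rebuilt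
    (hA : ∀ [SphereEmbedding.SmoothnessFacts] (K : Knot),
      ∃ K₀ : Knot, IsRegularNormalConnectedSum K K.mirror.reverse K₀ ∧ K₀.IsSmoothlySlice)
    (hR : Schubert1949_normalPosition_rebuilt) :
    ∀ [SphereEmbedding.SmoothnessFacts] {K K' : Knot},
      IsRegularNormalConnectedSum K K.mirror.reverse K' → K'.IsSmoothlySlice :=
  isSmoothlySlice_of_isRegularNormalConnectedSum_mirror_reverse_of_normalPosition_regular hA
    (Schubert1949_normalPosition_regular_of_rebuilt
      BandData.isIsotopic_of_band_eq_of_isRegular_holds hR)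

/-- **Fox–Milnor, printed reading, from (A) with a regular normal witness**: every *regular*
presentation of `K # K.mirror.reverse` is smoothly slice, granted `hA`, the ball form of the
smooth Schoenflies theorem in `𝕊³` (`hBall`, `SphereEmbedding.schoenflies_exists_ball`, needed to
bring an arbitrary splitting sphere to the equator) and the heart (`hR`,
`Knot.Schubert1949_normalPosition_rebuilt`); this is
`isSmoothlySlice_of_isRegularConnectedSum_mirror_reverse_of_ball_of_rebuilt` fed with
`exists_isRegularConnectedSum_mirror_reverse_isSmoothlySlice_of_normal`. Upstream set:
{`SphereEmbedding.schoenflies_exists_ball`, `Knot.Schubert1949_normalPosition_rebuilt`}.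
Fox–Milnor (1966), §3 Lemma 3 (p. 263); Cromwell (2004), §4.6.
[cite: FoxMilnor1966, §3 Lemma 3, p. 263] -/
theorem isSmoothlySlice_of_isRegularConnectedSum_mirror_reverse_of_normal_of_ball_of_rebuilt
    (hA : ∀ [SphereEmbedding.SmoothnessFacts] (K : Knot),
      ∃ K₀ : Knot, IsRegularNormalConnectedSum K K.mirror.reverse K₀ ∧ K₀.IsSmoothlySlice)
    (hBall : SphereEmbedding.schoenflies_exists_ball) (hR : Schubert1949_normalPosition_rebuilt) :
    ∀ [SphereEmbedding.SmoothnessFacts] {K K' : Knot},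
      IsRegularConnectedSum K K.mirror.reverse K' → K'.IsSmoothlySlice :=
  isSmoothlySlice_of_isRegularConnectedSum_mirror_reverse_of_ball_of_rebuilt
    (exists_isRegularConnectedSum_mirror_reverse_isSmoothlySlice_of_normal hA) hBall hR

/-- **The fact as stated implies its normal reading**: if every corner-free connected sum of `K`
and `K.mirror.reverse` is slice, so is every regular normal one. [folklore] -/
theorem isSmoothlySlice_of_isRegularNormalConnectedSum_mirror_reverse_of_general
    (h : isSmoothlySlice_of_isConnectedSum_mirror_reverse) :
    ∀ [SphereEmbedding.SmoothnessFacts] {K K' : Knot},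
      IsRegularNormalConnectedSum K K.mirror.reverse K' → K'.IsSmoothlySlice :=
  fun h' ↦ h h'.isRegularConnectedSum.isConnectedSum

/-! ## The package for the concordance invariance of `s` -/

/-- **`K # (-K̄')` and `K' # (-K̄')` for concordant `K ~ K'`: concordant regular normal
presentations, both smoothly slice.** Granted (A) with a regular normal witness (`hA`) and
Schubert's theorem in normal position for regular presentations (`hH`): if `K ~ K'`, the carrying
construction (`exists_isRegularNormalConnectedSum_isConcordant_left`, proved) gives regular normal
presentations `L` of `K # K'.mirror.reverse` and `L'` of `K' # K'.mirror.reverse` with `L ~ L'`;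
`L'` is slice by
`isSmoothlySlice_of_isRegularNormalConnectedSum_mirror_reverse_of_normalPosition_regular`, and `L`,
being concordant to a slice knot, is slice (`isSmoothlySlice_iff_isConcordant_unknot_holds`,
`equivalence_isConcordant_holds`). This is the form of Fox–Milnor's Lemma 3 used in Rasmussen's
proof that `s` is a concordance invariant (Rasmussen (2010), proof of Thm. 2, §4.4; in the tree
`HasRasmussenInvariant.eq_of_isConcordant_of_mirror_reverse`, `RasmussenConcordanceProofs.lean`).
Fox–Milnor (1966), §3 Lemma 3 (p. 263) and the equivalence relation `∼` of p. 264.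
[cite: FoxMilnor1966, §3 Lemma 3, p. 263] -/
theorem IsConcordant.exists_isRegularNormalConnectedSum_mirror_reverse_isSmoothlySlice
    (hA : ∀ [SphereEmbedding.SmoothnessFacts] (K : Knot),
      ∃ K₀ : Knot, IsRegularNormalConnectedSum K K.mirror.reverse K₀ ∧ K₀.IsSmoothlySlice)
    (hH : Schubert1949_normalPosition_regular) [SphereEmbedding.SmoothnessFacts] {K K' : Knot}
    (hc : K.IsConcordant K') :
    ∃ L L' : Knot, IsRegularNormalConnectedSum K K'.mirror.reverse L ∧
      IsRegularNormalConnectedSum K' K'.mirror.reverse L' ∧ L.IsConcordant L' ∧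
      L.IsSmoothlySlice ∧ L'.IsSmoothlySlice := by
  obtain ⟨L, L', hL, hL', hLL'⟩ :=
    exists_isRegularNormalConnectedSum_isConcordant_left K'.mirror.reverse hc
  have hL's : L'.IsSmoothlySlice :=
    isSmoothlySlice_of_isRegularNormalConnectedSum_mirror_reverse_of_normalPosition_regular hA hH hL'
  have hLs : L.IsSmoothlySlice :=
    isSmoothlySlice_iff_isConcordant_unknot_holds.2
      (equivalence_isConcordant_holds.trans hLL'
        (isSmoothlySlice_iff_isConcordant_unknot_holds.1 hL's))
  exact ⟨L, L', hL, hL', hLL', hLs, hL's⟩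

/-- The same package from (A) with a regular normal witness and the heart
`Knot.Schubert1949_normalPosition_rebuilt` alone. [cite: FoxMilnor1966, §3 Lemma 3, p. 263] -/
theorem IsConcordant.exists_isRegularNormalConnectedSum_mirror_reverse_isSmoothlySlice_of_rebuilt
    (hA : ∀ [SphereEmbedding.SmoothnessFacts] (K : Knot),
      ∃ K₀ : Knot, IsRegularNormalConnectedSum K K.mirror.reverse K₀ ∧ K₀.IsSmoothlySlice)
    (hR : Schubert1949_normalPosition_rebuilt) [SphereEmbedding.SmoothnessFacts] {K K' : Knot}
    (hc : K.IsConcordant K') :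
    ∃ L L' : Knot, IsRegularNormalConnectedSum K K'.mirror.reverse L ∧
      IsRegularNormalConnectedSum K' K'.mirror.reverse L' ∧ L.IsConcordant L' ∧
      L.IsSmoothlySlice ∧ L'.IsSmoothlySlice :=
  IsConcordant.exists_isRegularNormalConnectedSum_mirror_reverse_isSmoothlySlice hA
    (Schubert1949_normalPosition_regular_of_rebuilt
      BandData.isIsotopic_of_band_eq_of_isRegular_holds hR) hc

end Knot

end Literature.Topology.FourManifolds
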